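import Literature.Topology.FourManifolds.HomotopySpheresInverse
import Literature.Topology.FourManifolds.RotationBodyRetract
import Literature.Topology.FourManifolds.HomotopySpheresSumProofs
import Literature.Topology.FourManifolds.SmoothPoincareLowDim
import Literature.AlgebraicTopology.Homotopy.WhiteheadContractibleLeaves
import Literature.AlgebraicTopology.SingularHomology.HurewiczVanishing
import HarnessLib

/-!
# Kervaire–Milnor's Lemma 2.4, assembled: `Σ # (-Σ)` bounds a contractible manifold, from the remaining leaves

Topic `Literature/Topology/FourManifolds`, sibling proofs file of `HomotopySpheresInverse.lean`
(fact seat of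
`Literature.Topology.FourManifolds.HomotopySphere.exists_isOrientedConnectedSum_neg_boundsContractible`).
Kervaire–Milnor, *Groups of homotopy spheres I*, Ann. of Math. 77 (1963), Lemma 2.4 (p. 507):
"If `M` is a homotopy sphere, then `M # (-M)` bounds a contractible manifold." Printed proof:
the manifold `W` obtained from `(M - i(½D̊ⁿ)) × [0, π] + Sⁿ⁻¹ × H²` by identifying `i(tu) × θ`
with `u × ((2t-1) sin θ, (2t-1) cos θ)` "is a differentiable manifold with `bW = M # (-M)`.
Furthermore `W` contains `M - Interior i(½Dⁿ)` as deformation retract, and therefore is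
contractible."

`HomotopySpheresInverse.lean` splits the existential form of the lemma (the named fact
`HomotopySphere.exists_isOrientedConnectedSum_neg_boundsContractible`: for every homotopy
`n`-sphere `(Σ, o)`, `n ≥ 2`, SOME oriented connected sum `(Σ, o) # (Σ, -o)` bounds a
contractible manifold) into

* the **rotation construction** `HomotopySphere.exists_nullCobordism_isOrientedConnectedSum_neg`
  (some `Σ # (-Σ)` is `∂W` with `W ≃ₕ Σ ∖ {p}`) — smooth; carried out in `RotationBody.lean`,
  `RotationBodyBoundary.lean`, `RotationBodyRetract.lean` and DISCHARGED here
  (`HomotopySphere.exists_nullCobordism_isOrientedConnectedSum_neg_holds`, a twelve-line assembly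
  of those files), and
* the **contractibility of punctured homotopy spheres**
  `HomotopySphere.contractibleSpace_compl_singleton` (the sentence "and therefore is
  contractible"), itself reduced in `HomotopySpheresSumProofs.lean`
  (`HomotopySphere.contractibleSpace_compl_singleton_of`) to the Whitehead–Hurewicz recognition
  principle for manifolds (`n ≥ 3`; general position, Mayer–Vietoris and the vanishing of
  `H₊(Σ ∖ {p})` are proved there) and the smooth Poincaré conjecture in dimension `2` (`n = 2`),

and proves the existential lemma from the two (`…_boundsContractible_of`). This file records what
follows now that the smooth half is a theorem — everything below is PROVED, no new named facts:

* `HomotopySphere.exists_isOrientedConnectedSum_neg_boundsContractible_of_contractibleSpace_compl_singleton`: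
  the target fact GIVEN only `HomotopySphere.contractibleSpace_compl_singleton`;
* `HomotopySphere.boundsContractible_of_isOrientedConnectedSum_neg_of_contractibleSpace_compl_singleton`:
  Lemma 2.4 for EVERY sum `Σ # (-Σ)` GIVEN in addition the Palais–Cerf uniqueness of oriented
  connected sums (Lemma 2.1; tree fact
  `exists_diffeomorph_isOrientationPreserving_of_isOrientedConnectedSum`);
* `HomotopySphere.exists_isOrientedConnectedSum_neg_boundsContractible_of_three_le`: the target
  in every dimension `n ≥ 3` GIVEN only the recognition principle
  `Literature.AlgebraicTopology.Homotopy.Manifold.contractibleSpace_of_simplyConnected_of_acyclic`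
  (Bredon 1993, VII Cor. 10.11 with Milnor 1959, Cor. 1);
* `HomotopySphere.exists_isOrientedConnectedSum_neg_boundsContractible_of_whitehead`: the target
  (all `n ≥ 2`) GIVEN the recognition principle and the smooth Poincaré conjecture in dimension
  `2` (`nonemptyDiffeomorphSphere_two`, `SmoothPoincareLowDim.lean`: classification of surfaces);
* `contractibleSpace_of_simplyConnected_of_acyclic_of_hurewiczSubsingleton_of_cwType`: the
  recognition principle itself GIVEN the *vanishing form* of the Hurewicz theorem
  (`Literature.AlgebraicTopology.SingularHomology.hurewicz_subsingleton`, `HurewiczVanishing.lean`: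
  `(n-1)`-connected and `Hₙ = 0` imply `πₙ = 0`; Hatcher 2002, Thm. 4.32 at the zero group) and
  Milnor's theorem on the CW homotopy type of manifolds
  (`Literature.AlgebraicTopology.Homotopy.Manifold.exists_cwComplex_homotopyEquiv`, Milnor 1959,
  Cor. 1) — Whitehead's contractibility criterion being proved in the tree
  (`Literature.AlgebraicTopology.Homotopy.whitehead_contractibleSpace_holds`); the companion of
  `Manifold.contractibleSpace_of_simplyConnected_of_acyclic_of_hurewicz_of_cwType`
  (`WhiteheadContractibleLeaves.lean`, from the isomorphism clause `hurewicz_iso`);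
* `HomotopySphere.exists_isOrientedConnectedSum_neg_boundsContractible_of_hurewiczSubsingleton`,
  `…_of_leaves`, `…_of_facts`: the target GIVEN the three leaves that remain named facts in the
  tree — Hurewicz (vanishing form `hurewicz_subsingleton`, resp. the printed isomorphism clause
  `hurewicz_iso`), `Manifold.exists_cwComplex_homotopyEquiv`, and the classification of surfaces
  in the shape `nonemptyDiffeomorphSphere_two` (resp. spc4.S32, `nonemptyDiffeomorphSphere_of_mem`).

Deliberately NOT here: the discharge `…_boundsContractible_holds` itself — the three leaves are
theorems of algebraic/differential topology absent from Mathlib and the tree (Hurewicz; CW type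
or CW domination of manifolds; classification of closed simply connected surfaces).

## References

* M. Kervaire, J. Milnor, *Groups of homotopy spheres I*, Ann. of Math. (2) 77 (1963), 504–537:
  Lemma 2.1 (p. 505), Lemma 2.4 and its proof (p. 507). doi:10.2307/1970128
  [KervaireMilnorAnnals1963]
* G. E. Bredon, *Topology and Geometry*, GTM 139, Springer (1993), Ch. VII, Cor. 10.11. [Bredon1993]
* J. Milnor, *On spaces having the homotopy type of a CW-complex*, Trans. Amer. Math. Soc. 90
  (1959), 272–280, Cor. 1. [Milnor1959]
* A. Hatcher, *Algebraic Topology*, CUP (2002), §4.1 Thm. 4.5, §4.2 Thm. 4.32. [HatcherAT2002]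
-/

noncomputable section

open scoped Manifold ContDiff ContinuousMap Topology

universe u

namespace Literature.Topology.FourManifolds

/-! ### Lemma 2.4: Kervaire–Milnor's rotation construction, discharged -/

/-- **The smooth half of Kervaire–Milnor's Lemma 2.4, discharged**: the named fact
`HomotopySphere.exists_nullCobordism_isOrientedConnectedSum_neg` holds — for every homotopy
`n`-sphere `(Σ, o)`, `n ≠ 0`, some closed smooth oriented `n`-manifold `(P, oP)` is an oriented
connected sum of `(Σ, o)` and `(Σ, -o)` and bounds a compact smooth `(n+1)`-manifold `W` homotopy
equivalent to the punctured homotopy sphere `Σ ∖ {p}` (Kervaire–Milnor, *Groups of homotopy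
spheres I*, Ann. of Math. 77 (1963), proof of Lemma 2.4, p. 507: the manifold `W` obtained from
`(M - i(½D̊ⁿ)) × [0, π] + Sⁿ⁻¹ × H²` by identifying `i(tu) × θ` with
`u × ((2t - 1) sin θ, (2t - 1) cos θ)` "is a differentiable manifold with `bW = M # (-M)`.
Furthermore `W` contains `M - Interior i(½Dⁿ)` as deformation retract"). Proof: take a
maximal-atlas chart `e` of `Σ` onto `ℝⁿ` (`RotationData`, `i = e⁻¹`; `nonempty_rotationData`) and
a constant orientation `o₀` of `ℝⁿ` for which `i` is orientation preserving into `(Σ, o)`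
(`RotationData.exists_isOrientationPreserving_i`), hence orientation reversing into `(Σ, -o)`;
the double `P₀` of `Σ` along `i` (the glued manifold of the connected sum data `(e, e)`) is an
oriented connected sum `(Σ, o) # (Σ, -o)` (`RotationData.isOrientedConnectedSum_P₀`), it bounds
the rotation body `W` (`RotationData.nullCobordism`, `RotationBodyBoundary.lean`), and
`W ≃ₕ Σ ∖ {i 0}` (`RotationData.homotopyEquivPunct`, `RotationBodyRetract.lean`).
[cite: KervaireMilnorAnnals1963, Lemma 2.4, proof (p. 507)] -/
theorem HomotopySphere.exists_nullCobordism_isOrientedConnectedSum_neg_holds :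
    HomotopySphere.exists_nullCobordism_isOrientedConnectedSum_neg := by
  intro n S hn
  obtain ⟨m, rfl⟩ := Nat.exists_eq_succ_of_ne_zero hn
  haveI := S.connectedSpace hn
  obtain ⟨R⟩ := nonempty_rotationData (m := m) (M := S.carrier)
  obtain ⟨o₀, h₁⟩ := R.exists_isOrientationPreserving_i S.orientation
  haveI := R.csd.t2Space_glued RotationData.hn
  haveI := R.csd.compactSpace_glued RotationData.hn
  haveI := R.csd.secondCountableTopology_glued RotationData.hn
  exact ⟨R.P₀, inferInstance, inferInstance, inferInstance, inferInstance, inferInstance,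
    inferInstance, R.orientationP₀ S.orientation o₀ h₁, R.nullCobordism, R.i 0,
    R.isOrientedConnectedSum_P₀ S.orientation o₀ h₁, ⟨R.homotopyEquivPunct⟩⟩


/-! ### The existential Lemma 2.4 from the contractibility of punctured homotopy spheres -/

/-- **The existential Lemma 2.4 from the contractibility of punctured homotopy spheres alone.**
GIVEN `HomotopySphere.contractibleSpace_compl_singleton` (a homotopy `n`-sphere minus a point is
contractible, `n ≥ 2`: the homotopy theory in Kervaire–Milnor's proof, "and therefore is
contractible"), for every homotopy `n`-sphere `(Σ, o)`, `n ≥ 2`, some oriented connected sum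
`(Σ, o) # (Σ, -o)` bounds a contractible manifold — the smooth half being the theorem
`HomotopySphere.exists_nullCobordism_isOrientedConnectedSum_neg_holds` (Kervaire–Milnor, *Groups
of homotopy spheres I* (1963), Lemma 2.4 and its proof, p. 507: `bW = M # (-M)` and `W`
deformation retracts onto `M - Interior i(½Dⁿ)`; reduction
`HomotopySphere.exists_isOrientedConnectedSum_neg_boundsContractible_of` of
`HomotopySpheresInverse.lean`). [cite: KervaireMilnorAnnals1963, Lemma 2.4, proof (p. 507)] -/
theorem HomotopySphere.exists_isOrientedConnectedSum_neg_boundsContractible_of_contractibleSpace_compl_singleton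
    (h24b : HomotopySphere.contractibleSpace_compl_singleton) :
    HomotopySphere.exists_isOrientedConnectedSum_neg_boundsContractible :=
  HomotopySphere.exists_isOrientedConnectedSum_neg_boundsContractible_of
    HomotopySphere.exists_nullCobordism_isOrientedConnectedSum_neg_holds h24b

/-- **Kervaire–Milnor's Lemma 2.4 for every sum, from the contractibility of punctured homotopy
spheres and the Palais–Cerf uniqueness of oriented connected sums.** GIVEN
`HomotopySphere.contractibleSpace_compl_singleton` and the uniqueness of oriented connected sums
of connected closed oriented manifolds up to orientation-preserving diffeomorphism (tree fact
`exists_diffeomorph_isOrientationPreserving_of_isOrientedConnectedSum`; Kervaire–Milnor's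
Lemma 2.1, "well defined" by the disc theorem of Palais and Cerf), EVERY oriented connected sum
`(Σ, o) # (Σ, -o)` of a homotopy `n`-sphere, `n ≥ 2`, and its reverse bounds a contractible
manifold (Kervaire–Milnor 1963, Lemmas 2.1 and 2.4; reduction
`HomotopySphere.boundsContractible_of_isOrientedConnectedSum_neg_of_exists`).
[cite: KervaireMilnorAnnals1963, Lemmas 2.1 and 2.4 (pp. 505, 507)] -/
theorem HomotopySphere.boundsContractible_of_isOrientedConnectedSum_neg_of_contractibleSpace_compl_singleton
    (h24b : HomotopySphere.contractibleSpace_compl_singleton)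
    (hPC : ∀ (n : ℕ) (S : HomotopySphere n) (P P' : Type) [TopologicalSpace P] [T2Space P]
      [SecondCountableTopology P] [ChartedSpace (EuclideanSpace ℝ (Fin n)) P]
      [IsManifold (𝓡 n) ∞ P] [CompactSpace P] [TopologicalSpace P'] [T2Space P']
      [SecondCountableTopology P'] [ChartedSpace (EuclideanSpace ℝ (Fin n)) P']
      [IsManifold (𝓡 n) ∞ P'] [CompactSpace P'],
      exists_diffeomorph_isOrientationPreserving_of_isOrientedConnectedSum (IM := 𝓡 n)
        (IN := 𝓡 n) (IP := 𝓡 n) (IP' := 𝓡 n) (M := S.carrier) (N := S.carrier) (P := P)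
        (P' := P')) :
    HomotopySphere.boundsContractible_of_isOrientedConnectedSum_neg :=
  HomotopySphere.boundsContractible_of_isOrientedConnectedSum_neg_of_exists
    (HomotopySphere.exists_isOrientedConnectedSum_neg_boundsContractible_of_contractibleSpace_compl_singleton
      h24b) hPC

/-! ### Down to the leaves: Whitehead–Hurewicz (`n ≥ 3`) and the classification of surfaces (`n = 2`) -/

/-- **The existential Lemma 2.4 in dimensions `n ≥ 3`, from the Whitehead–Hurewicz recognition
principle alone.** GIVEN
`Literature.AlgebraicTopology.Homotopy.Manifold.contractibleSpace_of_simplyConnected_of_acyclic`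
(a simply connected Hausdorff second countable topological manifold with vanishing integral
homology in positive degrees is contractible: Bredon 1993, VII Cor. 10.11, with Milnor 1959,
Cor. 1), for every homotopy `n`-sphere `(Σ, o)`, `n ≥ 3`, some oriented connected sum
`(Σ, o) # (Σ, -o)` bounds a contractible manifold: the rotation body `W` of
`HomotopySphere.exists_nullCobordism_isOrientedConnectedSum_neg_holds` is homotopy equivalent to
`Σ ∖ {p}`, which is simply connected (general position, `n ≥ 3`) and acyclic (Mayer–Vietoris),
hence contractible (`HomotopySphere.contractibleSpace_compl_singleton_of_whitehead`,
`HomotopySpheresSumProofs.lean`), and contractibility is a homotopy invariant. This covers every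
dimension in which Kervaire–Milnor's proof of Theorem 1.1 invokes Lemma 2.4 except `n = 2`, where
the contractibility of `Σ ∖ {p}` is the classification of surfaces.
[cite: KervaireMilnorAnnals1963, Lemma 2.4, proof (p. 507)] -/
theorem HomotopySphere.exists_isOrientedConnectedSum_neg_boundsContractible_of_three_le
    (hW : Literature.AlgebraicTopology.Homotopy.Manifold.contractibleSpace_of_simplyConnected_of_acyclic.{0})
    {n : ℕ} (h3 : 3 ≤ n) (S : HomotopySphere n) :
    ∃ (P : Type) (_ : TopologicalSpace P) (_ : T2Space P) (_ : SecondCountableTopology P)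
      (_ : ChartedSpace (EuclideanSpace ℝ (Fin n)) P) (_ : IsManifold (𝓡 n) ∞ P)
      (_ : CompactSpace P) (oP : SmoothOrientation (𝓡 n) P),
      IsOrientedConnectedSum S.orientation (-S.orientation) oP ∧ BoundsContractible n P := by
  obtain ⟨P, _, _, _, _, _, _, oP, c, p, hP, ⟨e⟩⟩ :=
    HomotopySphere.exists_nullCobordism_isOrientedConnectedSum_neg_holds n S (by omega)
  haveI : ContractibleSpace {x : S.carrier // x ≠ p} :=
    HomotopySphere.contractibleSpace_compl_singleton_of_whitehead hW h3 S p
  haveI : ContractibleSpace c.W := e.contractibleSpace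
  exact ⟨P, ‹_›, ‹_›, ‹_›, ‹_›, ‹_›, ‹_›, oP, hP, c, inferInstance⟩

/-- **The existential Lemma 2.4 (all `n ≥ 2`) from the Whitehead–Hurewicz recognition principle
and the smooth Poincaré conjecture in dimension `2`.** GIVEN
`Literature.AlgebraicTopology.Homotopy.Manifold.contractibleSpace_of_simplyConnected_of_acyclic`
(used for `n ≥ 3`) and `nonemptyDiffeomorphSphere_two` (every Hausdorff second countable smooth
surface homotopy equivalent to `𝕊²` is diffeomorphic to it — the classification of surfaces, used
for `n = 2` only, where `Σ ∖ {p} ≅ 𝕊² ∖ {pt} ≅ ℝ²` by stereographic projection), the named fact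
`HomotopySphere.exists_isOrientedConnectedSum_neg_boundsContractible` holds: the two hypotheses
make punctured homotopy spheres contractible (`HomotopySphere.contractibleSpace_compl_singleton_of`,
`HomotopySpheresSumProofs.lean`), and the smooth half is the theorem
`HomotopySphere.exists_nullCobordism_isOrientedConnectedSum_neg_holds`.
[cite: KervaireMilnorAnnals1963, Lemma 2.4, proof (p. 507)] -/
theorem HomotopySphere.exists_isOrientedConnectedSum_neg_boundsContractible_of_whitehead
    (hW : Literature.AlgebraicTopology.Homotopy.Manifold.contractibleSpace_of_simplyConnected_of_acyclic.{0})
    (h2 : nonemptyDiffeomorphSphere_two.{0}) :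
    HomotopySphere.exists_isOrientedConnectedSum_neg_boundsContractible :=
  HomotopySphere.exists_isOrientedConnectedSum_neg_boundsContractible_of_contractibleSpace_compl_singleton
    (HomotopySphere.contractibleSpace_compl_singleton_of hW fun M _ _ _ => h2 M)

/-! ### The finest current leaves: the vanishing form of Hurewicz and Milnor's CW type -/

/-- **The Whitehead–Hurewicz recognition principle for manifolds from the vanishing form of the
Hurewicz theorem and Milnor's CW type.** The named fact
`Literature.AlgebraicTopology.Homotopy.Manifold.contractibleSpace_of_simplyConnected_of_acyclic`
(a simply connected Hausdorff second countable topological `n`-manifold `M` with `Hₖ(M; ℤ) = 0`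
for all `k ≥ 1` is contractible; Bredon 1993, VII Cor. 10.11, with Milnor 1959, Cor. 1) GIVEN
(a) the vanishing form of Hurewicz's theorem
(`Literature.AlgebraicTopology.SingularHomology.hurewicz_subsingleton`: an `(n-1)`-connected space
with `Hₙ = 0` has `πₙ = 0`; Hatcher 2002, Thm. 4.32 evaluated at the zero group) and (b) Milnor's
theorem that such manifolds have the homotopy type of CW complexes
(`Literature.AlgebraicTopology.Homotopy.Manifold.exists_cwComplex_homotopyEquiv`). Proof: all
`π_k(M)` vanish (`subsingleton_homotopyGroup_of_isZero_singularHomology_of_subsingleton`,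
induction on `k`), hence so do those of the CW complex `C ≃ₕ M`
(`subsingleton_homotopyGroup_of_homotopyEquiv`), which is therefore contractible by Whitehead's
criterion, proved in the tree (`whitehead_contractibleSpace_holds`, Hatcher Thm. 4.5 / p. 348);
so is `M`. The companion of `Manifold.contractibleSpace_of_simplyConnected_of_acyclic_of_hurewicz_of_cwType`
(`WhiteheadContractibleLeaves.lean`), which assumes the printed isomorphism clause `hurewicz_iso`
instead. [cite: Bredon1993, Ch. VII Cor. 10.11] -/
theorem contractibleSpace_of_simplyConnected_of_acyclic_of_hurewiczSubsingleton_of_cwType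
    (hH : Literature.AlgebraicTopology.SingularHomology.hurewicz_subsingleton.{u})
    (hCW : Literature.AlgebraicTopology.Homotopy.Manifold.exists_cwComplex_homotopyEquiv.{u}) :
    Literature.AlgebraicTopology.Homotopy.Manifold.contractibleSpace_of_simplyConnected_of_acyclic.{u} := by
  intro n M _ _ _ _ _ hac
  obtain ⟨C, _, _, _, -, ⟨e⟩⟩ := hCW n M
  have hM := Literature.AlgebraicTopology.SingularHomology.subsingleton_homotopyGroup_of_isZero_singularHomology_of_subsingleton
    hH hac
  haveI : SimplyConnectedSpace C := e.symm.simplyConnectedSpace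
  have hC : ∀ k : ℕ, 1 ≤ k → ∀ c : C, Subsingleton (π_ k C c) := fun k hk c =>
    Literature.AlgebraicTopology.Homotopy.subsingleton_homotopyGroup_of_homotopyEquiv e.symm (hM k hk) c
  haveI : ContractibleSpace C :=
    Literature.AlgebraicTopology.Homotopy.whitehead_contractibleSpace_holds C hC
  exact e.contractibleSpace

/-- **The existential Lemma 2.4 from the three finest leaves that remain named facts.** For every
homotopy `n`-sphere `(Σ, o)`, `n ≥ 2`, some oriented connected sum `(Σ, o) # (Σ, -o)` bounds a
contractible manifold (`HomotopySphere.exists_isOrientedConnectedSum_neg_boundsContractible`;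
Kervaire–Milnor 1963, Lemma 2.4), GIVEN (a) the vanishing form of the Hurewicz theorem
(`Literature.AlgebraicTopology.SingularHomology.hurewicz_subsingleton`, Hatcher 2002, Thm. 4.32),
(b) Milnor's theorem that second countable Hausdorff manifolds have the homotopy type of CW
complexes (`Literature.AlgebraicTopology.Homotopy.Manifold.exists_cwComplex_homotopyEquiv`,
Milnor 1959, Cor. 1) — (a) and (b) settle every `n ≥ 3`
(`contractibleSpace_of_simplyConnected_of_acyclic_of_hurewiczSubsingleton_of_cwType`) — and (c),
for `n = 2` only, the classification of closed simply connected surfaces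
(`nonemptyDiffeomorphSphere_two`). The rotation construction, `∂W ≅ Σ # (-Σ)`, the deformation
retraction `W ≃ₕ Σ ∖ {p}`, Whitehead's contractibility criterion, and the general-position and
Mayer–Vietoris computations for `Σ ∖ {p}` are theorems of the tree.
[cite: KervaireMilnorAnnals1963, Lemma 2.4, proof (p. 507)] -/
theorem HomotopySphere.exists_isOrientedConnectedSum_neg_boundsContractible_of_hurewiczSubsingleton
    (hH : Literature.AlgebraicTopology.SingularHomology.hurewicz_subsingleton.{0})
    (hCW : Literature.AlgebraicTopology.Homotopy.Manifold.exists_cwComplex_homotopyEquiv.{0})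
    (h2 : nonemptyDiffeomorphSphere_two.{0}) :
    HomotopySphere.exists_isOrientedConnectedSum_neg_boundsContractible :=
  HomotopySphere.exists_isOrientedConnectedSum_neg_boundsContractible_of_whitehead
    (contractibleSpace_of_simplyConnected_of_acyclic_of_hurewiczSubsingleton_of_cwType hH hCW) h2

/-- **The existential Lemma 2.4 from the printed leaves**: the named fact
`HomotopySphere.exists_isOrientedConnectedSum_neg_boundsContractible` GIVEN the isomorphism
clause of the Hurewicz theorem (`Literature.AlgebraicTopology.SingularHomology.hurewicz_iso`,
Hatcher 2002, Thm. 4.32: `πₙ(X) ≈ Hₙ(X)` for `(n-1)`-connected `X`, which implies the vanishing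
form, `hurewicz_subsingleton_of_iso`), Milnor's CW type of manifolds
(`Literature.AlgebraicTopology.Homotopy.Manifold.exists_cwComplex_homotopyEquiv`, Milnor 1959,
Cor. 1) and the classification of surfaces (`nonemptyDiffeomorphSphere_two`).
[cite: KervaireMilnorAnnals1963, Lemma 2.4, proof (p. 507)] -/
theorem HomotopySphere.exists_isOrientedConnectedSum_neg_boundsContractible_of_leaves
    (h432 : Literature.AlgebraicTopology.SingularHomology.hurewicz_iso.{0})
    (hCW : Literature.AlgebraicTopology.Homotopy.Manifold.exists_cwComplex_homotopyEquiv.{0})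
    (h2 : nonemptyDiffeomorphSphere_two.{0}) :
    HomotopySphere.exists_isOrientedConnectedSum_neg_boundsContractible :=
  HomotopySphere.exists_isOrientedConnectedSum_neg_boundsContractible_of_hurewiczSubsingleton
    (Literature.AlgebraicTopology.SingularHomology.hurewicz_subsingleton_of_iso h432) hCW h2

/-- The same, with the dimension-`2` input taken in the shape of spc4.S32
(`Literature.Topology.FourManifolds.nonemptyDiffeomorphSphere_of_mem`: the smooth Poincaré
conjecture in dimensions `1, 2, 3, 5, 6, 12, 56, 61`; only `n = 2` is used, via
`nonemptyDiffeomorphSphere_two_of_mem`): the named fact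
`HomotopySphere.exists_isOrientedConnectedSum_neg_boundsContractible` GIVEN `hurewicz_iso`,
`Manifold.exists_cwComplex_homotopyEquiv` and `nonemptyDiffeomorphSphere_of_mem`.
[cite: KervaireMilnorAnnals1963, Lemma 2.4, proof (p. 507)] -/
theorem HomotopySphere.exists_isOrientedConnectedSum_neg_boundsContractible_of_facts
    (h432 : Literature.AlgebraicTopology.SingularHomology.hurewicz_iso.{0})
    (hCW : Literature.AlgebraicTopology.Homotopy.Manifold.exists_cwComplex_homotopyEquiv.{0})
    (h32 : nonemptyDiffeomorphSphere_of_mem.{0}) :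
    HomotopySphere.exists_isOrientedConnectedSum_neg_boundsContractible :=
  HomotopySphere.exists_isOrientedConnectedSum_neg_boundsContractible_of_leaves h432 hCW
    (nonemptyDiffeomorphSphere_two_of_mem h32)

end Literature.Topology.FourManifolds

end
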